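import Mathlib
import Summits.Ventures.HodgeRepro.Tier4.Common.RowWeights
import Summits.Ventures.HodgeRepro.Tier4.Common.ArchAssemble
import Summits.Ventures.HodgeRepro.Tier4.Line4.TorusProduct
import Summits.Ventures.HodgeRepro.Tier4.Line4.CharacterExtend

/-!
# Tier4/Line4/WeightCharacter — the archimedean WEIGHT CHARACTER of the torus of a row plane with prescribed
`K`-type integers, and the wall's `_hchi` BY CONSTRUCTION from the extension theorem (C-L4-B-EXTEND, part 2 = (r4) of
S16573)

Blind re-derivation cell `pub-hodge-repro`, Tier 4 «prove the step» (README §9–§10), seat t4-x2 (reserve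
wall-breaker, gen 6; GO S16576).  Tree path `lean/Summits/Ventures/HodgeRepro/Tier4/Line4/WeightCharacter.lean`.
Imports: Mathlib + Common (`RowWeights`: `weightAt_mul`, `norm_weightAt_eq_one`, `continuous_weightAt`, `weightAt_one`;
`ArchAssemble`: `assemble`, `ofPlace`, `assemble_mem_infinitePart`) + Line4 (`TorusProduct`: `torusInf`;
`CharacterExtend`: `exists_torusT_character_complex_of_print`).  No definition, no instance, no printed theorem proved.

WHY.  The wall's half (B) asks a continuous unitary character `χ` of `T(𝔸)`, trivial on `T(k)`, whose archimedean
components cancel the `K`-type `(e₊ w, e₋ w)` at every infinite place `w` (`_hchi : ∀ w, ChiMatchesAt … (eP w) (eM w)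
χ`).  CharacterExtend gives every continuous character of `T_∞` an extension to `T(𝔸)` trivial on `T(k)`, modulo the
print [DE14] Cor. 3.6.2; what is left is the CHARACTER OF `T_∞` ITSELF — (r4) of L4-p2's S16573.  Here it is built:
* `weightAt_eq_one_of_mem_atPlace_ne` — the weights at `w′ ≠ w` of an element supported at `w` are `1`;
* `mem_infinitePart_of_mem_atPlace` — an element supported at one infinite place lies in `G_∞`;
* `exists_weight_character_ofLinesRow` — on a row plane `ofLinesRow q a b ε` (real CM places), for any integers
  `eP eM : InfinitePlace k → ℤ` there is a continuous character `ψ : T(𝔸) → 𝕋` with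
  `ψ κ = ∏_w weightAt … w 0 κ ^ (−eP w) · weightAt … w 1 κ ^ (−eM w)` (typer-2's RowWeights: the weights are
  multiplicative, of modulus one and continuous on the torus of a row plane);
* `weight_character_apply_of_mem_localTorusAt` — on the local torus at `w` only the `w`-factor survives;
* **`exists_wall_character_ktypes_ofLinesRow`** — the assembly: under the hypotheses of CharacterExtend's row-plane
  instance (closedness of `T(k)` and `T(k) ∩ T_∞ = 1` from L4-p2's TorusArchClosed as binders, cocompactness from
  TorusCocompactAniso, the print as `hDE`), for every `eP eM` there is `chi : T(𝔸) → ℂ` multiplicative, trivial on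
  `T(k)`, continuous, of modulus one, with `∀ w, ChiMatchesAt (ofLinesRow q a b ε) q w (eP w) (eM w) chi` — the wall's
  `chi`, `chi_mul`, `chi_rational`, `hc`, `hu`, `_hchi` for ONE torus, from the prescribed integers alone.
NOT here: the second torus `T′` (`ChiMatchesAt'`, `weightAt'`), the PAIR with the centre condition `chi_centre` (N2),
and the face's identity — the bridge's.  Nothing here says anything about the status of the Hodge conjecture for CM
abelian varieties, which is NOT proved; HC_CM is NOT proved by anyone in this repository.
-/

set_option autoImplicit false

noncomputable section

namespace Summit.Ventures.HodgeRepro.Tier4.Line4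

open NumberField Summit.Ventures.HodgeRepro.Tier4.Common Summit.Ventures.HodgeRepro.Tier4.Line1
  Summit.Ventures.HodgeRepro.Tier4.Lit

section Support

variable {k : Type} [Field k] [NumberField k] (W : PlaneData k) (q : QuadData k)

/-- **The weights at `w′ ≠ w` of an element supported at `w` are `1`** (its `w′`-component is the identity). -/
theorem weightAt_eq_one_of_mem_atPlace_ne {w w' : InfinitePlace k} (hne : w' ≠ w) {κ : GA W}
    (hκ : κ ∈ atPlace W w) (j : Fin 2) : weightAt W q w' j κ = 1 := by
  have h1 : GA.infiniteComponent W w' κ = 1 := hκ.2 w' hne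
  unfold weightAt entryAt
  rw [h1]
  have hne' : lineOmega j ≠ lineBase j := by fin_cases j <;> decide
  simp only [Units.val_one, Matrix.one_apply_eq, Matrix.one_apply_ne hne', map_one, map_zero, zero_mul, add_zero]

/-- An element supported at one infinite place lies in `G_∞` (it is its own `w`-slice, an assembly). -/
theorem mem_infinitePart_of_mem_atPlace {w : InfinitePlace k} {κ : GA W} (hκ : κ ∈ atPlace W w) :
    κ ∈ infinitePart W := by
  have h : ofPlace W w κ = κ := by
    apply GA.ext_of_components
    · intro w'
      by_cases hw : w' = w
      · subst hw; exact infiniteComponent_ofPlace_self W w' κ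
      · rw [infiniteComponent_ofPlace_of_ne W hw, hκ.2 w' hw]
    · intro v
      rw [ofPlace, finiteComponent_assemble, hκ.1 v]
  rw [← h, ofPlace]
  exact assemble_mem_infinitePart W _

end Support

section RowPlane

variable {k : Type} [Field k] [NumberField k] (q : QuadData k) (a b ε : k)

/-- **The archimedean weight character with prescribed `K`-type integers**: on the torus of a row plane (real CM
places) the function `κ ↦ ∏_w weightAt … w 0 κ ^ (−eP w) · weightAt … w 1 κ ^ (−eM w)` is a continuous character into
the circle group (RowWeights: each weight is multiplicative, of modulus one and continuous on the torus). -/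
theorem exists_weight_character_ofLinesRow (ha : a ≠ 0) (hb : b ≠ 0) (hε : ε ≠ 0)
    (hreal : ∀ w : InfinitePlace k, w.IsReal) (hcm : ∀ w, IsCMAt q w) (eP eM : InfinitePlace k → ℤ) :
    ∃ ψ : ContinuousMonoidHom (torusT (PlaneData.ofLinesRow q a b ε)) Circle,
      ∀ κ : torusT (PlaneData.ofLinesRow q a b ε), ((ψ κ : Circle) : ℂ) =
        ∏ w : InfinitePlace k, (weightAt (PlaneData.ofLinesRow q a b ε) q w 0 (κ : GA _) ^ (-(eP w)) *
          weightAt (PlaneData.ofLinesRow q a b ε) q w 1 (κ : GA _) ^ (-(eM w))) := by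
  set W := PlaneData.ofLinesRow q a b ε with hW
  -- the factor at `w` and its properties on the torus
  let fac : InfinitePlace k → torusT W → ℂ := fun w κ =>
    weightAt W q w 0 (κ : GA W) ^ (-(eP w)) * weightAt W q w 1 (κ : GA W) ^ (-(eM w))
  have hnorm0 : ∀ (w : InfinitePlace k) (κ : torusT W) (j : Fin 2), ‖weightAt W q w j (κ : GA W)‖ = 1 :=
    fun w κ j => norm_weightAt_eq_one q a b ε w ha hb hε (hreal w) (hcm w) j κ.2
  have hne0 : ∀ (w : InfinitePlace k) (κ : torusT W) (j : Fin 2), weightAt W q w j (κ : GA W) ≠ 0 :=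
    fun w κ j => by
      intro h
      have := hnorm0 w κ j
      rw [h, norm_zero] at this
      exact zero_ne_one this
  have hfac_norm : ∀ (w : InfinitePlace k) (κ : torusT W), ‖fac w κ‖ = 1 := by
    intro w κ
    simp only [fac, norm_mul, norm_zpow, hnorm0, one_zpow, mul_one]
  have hfac_mul : ∀ (w : InfinitePlace k) (κ κ' : torusT W), fac w (κ * κ') = fac w κ * fac w κ' := by
    intro w κ κ'
    simp only [fac, Subgroup.coe_mul]
    rw [weightAt_mul q a b ε w ha hb hε (hreal w) (hcm w) 0 κ.2 κ'.2,
      weightAt_mul q a b ε w ha hb hε (hreal w) (hcm w) 1 κ.2 κ'.2, mul_zpow, mul_zpow]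
    ring
  have hfac_one : ∀ w : InfinitePlace k, fac w 1 = 1 := by
    intro w
    simp only [fac, Subgroup.coe_one, weightAt_one, one_zpow, mul_one]
  have hfac_cont : ∀ w : InfinitePlace k, Continuous (fac w) := by
    intro w
    refine Continuous.mul ?_ ?_
    · exact ((continuous_weightAt q w W 0).comp continuous_subtype_val).zpow₀ _ (fun κ => Or.inl (hne0 w κ 0))
    · exact ((continuous_weightAt q w W 1).comp continuous_subtype_val).zpow₀ _ (fun κ => Or.inl (hne0 w κ 1))
  -- the product
  let F : torusT W → ℂ := fun κ => ∏ w : InfinitePlace k, fac w κ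
  have hF_norm : ∀ κ, ‖F κ‖ = 1 := by
    intro κ
    simp only [F, norm_prod, hfac_norm, Finset.prod_const_one]
  have hF_mem : ∀ κ, F κ ∈ Submonoid.unitSphere ℂ := fun κ => mem_sphere_zero_iff_norm.mpr (hF_norm κ)
  refine ⟨{ toFun := fun κ => ⟨F κ, hF_mem κ⟩
            map_one' := ?_
            map_mul' := ?_
            continuous_toFun := ?_ }, fun κ => rfl⟩
  · apply Subtype.ext
    show F 1 = 1
    simp only [F, hfac_one, Finset.prod_const_one]
  · intro κ κ'
    apply Subtype.ext
    show F (κ * κ') = F κ * F κ'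
    simp only [F, hfac_mul, Finset.prod_mul_distrib]
  · exact Continuous.subtype_mk (continuous_finsetProd _ fun w _ => hfac_cont w) _

/-- **On the local torus at `w` only the `w`-factor survives**: for `κ ∈ T` supported at `w`, the product of the
weight monomials is the monomial at `w`. -/
theorem weight_character_apply_of_mem_localTorusAt (eP eM : InfinitePlace k → ℤ) (w : InfinitePlace k)
    (κ : torusT (PlaneData.ofLinesRow q a b ε)) (hκ : (κ : GA _) ∈ localTorusAt (PlaneData.ofLinesRow q a b ε) w) :
    (∏ w' : InfinitePlace k, (weightAt (PlaneData.ofLinesRow q a b ε) q w' 0 (κ : GA _) ^ (-(eP w')) *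
        weightAt (PlaneData.ofLinesRow q a b ε) q w' 1 (κ : GA _) ^ (-(eM w')))) =
      weightAt (PlaneData.ofLinesRow q a b ε) q w 0 (κ : GA _) ^ (-(eP w)) *
        weightAt (PlaneData.ofLinesRow q a b ε) q w 1 (κ : GA _) ^ (-(eM w)) := by
  rw [Finset.prod_eq_single w]
  · intro w' _ hne
    rw [weightAt_eq_one_of_mem_atPlace_ne _ q hne hκ.2 0, weightAt_eq_one_of_mem_atPlace_ne _ q hne hκ.2 1,
      one_zpow, one_zpow, mul_one]
  · intro h
    exact absurd (Finset.mem_univ w) h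

/-- **THE WALL'S CHARACTER FOR ONE TORUS, WITH THE PRESCRIBED `K`-TYPES, modulo the print**: on a row plane
`ofLinesRow q a b ε` (real CM places; `hg`, `hA` for the cocompactness of `T(k)` in `T(𝔸)`; `[hcl]` and `hbot` =
L4-p2's TorusArchClosed `isClosed_rationalOf_torusT` / `rationalOf_inf_torusInf_eq_bot`; `hDE` = the print [DE14]
Cor. 3.6.2 on the compact quotient `T(k)\T(𝔸)`, in the binder shape of CharacterExtend's
`exists_torusT_ofLinesRow_character_extend_of_print`), for any integers `eP eM : InfinitePlace k → ℤ` there is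
`chi : T(𝔸) → ℂ`, multiplicative, trivial on `T(k)`, continuous, of modulus one, with
`ChiMatchesAt (ofLinesRow q a b ε) q w (eP w) (eM w) chi` at every infinite place `w` — the wall's `chi`, `chi_mul`,
`chi_rational`, `hc`, `hu` and `_hchi` for the torus `T`, by construction. -/
theorem exists_wall_character_ktypes_ofLinesRow (ha : a ≠ 0) (hb : b ≠ 0) (hε : ε ≠ 0)
    (hreal : ∀ w : InfinitePlace k, w.IsReal) (hcm : ∀ w, IsCMAt q w)
    (hg : IsGenuineRow (PlaneData.ofLinesRow q a b ε)) (hA : IsAnisotropic (PlaneData.ofLinesRow q a b ε))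
    [hcl : IsClosed ((rationalOf (PlaneData.ofLinesRow q a b ε) (torusT (PlaneData.ofLinesRow q a b ε)) :
      Subgroup (torusT (PlaneData.ofLinesRow q a b ε))) : Set (torusT (PlaneData.ofLinesRow q a b ε)))]
    (hbot : rationalOf (PlaneData.ofLinesRow q a b ε) (torusT (PlaneData.ofLinesRow q a b ε)) ⊓
      torusInf (PlaneData.ofLinesRow q a b ε) = ⊥)
    (hDE : letI : CommGroup (torusT (PlaneData.ofLinesRow q a b ε)) :=
        { (inferInstance : Group (torusT (PlaneData.ofLinesRow q a b ε))) with
          mul_comm := fun g h => Subtype.ext (torusT_ofLinesRow_comm q a b ε ha hb hε g h g.2 h.2) }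
      haveI : CompactSpace (torusT (PlaneData.ofLinesRow q a b ε) ⧸
          rationalOf (PlaneData.ofLinesRow q a b ε) (torusT (PlaneData.ofLinesRow q a b ε))) :=
        compactSpace_quotient_of_cocompact _ (cocompact_rationalOf_torusT_of_anisotropic _ hg hA)
      DeitmarEchterhoff2014_Cor_3_6_2_restriction_surjective (torusT (PlaneData.ofLinesRow q a b ε) ⧸
        rationalOf (PlaneData.ofLinesRow q a b ε) (torusT (PlaneData.ofLinesRow q a b ε))))
    (eP eM : InfinitePlace k → ℤ) :
    ∃ chi : torusT (PlaneData.ofLinesRow q a b ε) → ℂ,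
      (∀ s t : torusT (PlaneData.ofLinesRow q a b ε), chi (s * t) = chi s * chi t) ∧
      (∀ t ∈ rationalOf (PlaneData.ofLinesRow q a b ε) (torusT (PlaneData.ofLinesRow q a b ε)), chi t = 1) ∧
      Continuous chi ∧ (∀ t, ‖chi t‖ = 1) ∧
      ∀ w : InfinitePlace k, ChiMatchesAt (PlaneData.ofLinesRow q a b ε) q w (eP w) (eM w) chi := by
  obtain ⟨ψ, hψ⟩ := exists_weight_character_ofLinesRow q a b ε ha hb hε hreal hcm eP eM
  -- the restriction of `ψ` to `T_∞`
  let ι : ContinuousMonoidHom (torusInf (PlaneData.ofLinesRow q a b ε)) (torusT (PlaneData.ofLinesRow q a b ε)) :=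
    { (torusInf (PlaneData.ofLinesRow q a b ε)).subtype with continuous_toFun := continuous_subtype_val }
  let ψ' : ContinuousMonoidHom (torusInf (PlaneData.ofLinesRow q a b ε)) Circle := ψ.comp ι
  haveI : CompactSpace (torusInf (PlaneData.ofLinesRow q a b ε)) :=
    compactSpace_infinitePart_subgroupOf_torusT_ofLinesRow q a b ε ha hb hε hreal hcm
  obtain ⟨chi, hmul, hrat, hcont, hunit, hinf⟩ :=
    exists_torusT_character_complex_of_print (PlaneData.ofLinesRow q a b ε)
      (fun g h => Subtype.ext (torusT_ofLinesRow_comm q a b ε ha hb hε g h g.2 h.2))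
      (cocompact_rationalOf_torusT_of_anisotropic _ hg hA) hbot hDE ψ'
  refine ⟨chi, hmul, hrat, hcont, hunit, fun w κ hκ => ?_⟩
  -- `κ` lies in `T_∞`
  have hκinf : κ ∈ torusInf (PlaneData.ofLinesRow q a b ε) := by
    rw [torusInf, Subgroup.mem_subgroupOf]
    exact mem_infinitePart_of_mem_atPlace _ hκ.2
  have h1 : chi κ = ((ψ κ : Circle) : ℂ) := hinf ⟨κ, hκinf⟩
  rw [h1, hψ κ, weight_character_apply_of_mem_localTorusAt q a b ε eP eM w κ hκ]
  have hne0 : ∀ j : Fin 2, weightAt (PlaneData.ofLinesRow q a b ε) q w j (κ : GA _) ≠ 0 := by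
    intro j h
    have := norm_weightAt_eq_one q a b ε w ha hb hε (hreal w) (hcm w) j κ.2
    rw [h, norm_zero] at this
    exact zero_ne_one this
  have hA0 : weightAt (PlaneData.ofLinesRow q a b ε) q w 0 (κ : GA _) ^ (eP w) ≠ 0 := zpow_ne_zero _ (hne0 0)
  have hB0 : weightAt (PlaneData.ofLinesRow q a b ε) q w 1 (κ : GA _) ^ (eM w) ≠ 0 := zpow_ne_zero _ (hne0 1)
  rw [zpow_neg, zpow_neg]
  field_simp

end RowPlane

end Summit.Ventures.HodgeRepro.Tier4.Line4

end
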